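import Literature.AlgebraicTopology.SingularHomology.RelativeCochainsMaps
import Literature.AlgebraicTopology.SingularHomology.ExcisionTheorem
import Literature.AlgebraicTopology.SingularHomology.SubsetCochains
import Mathlib.LinearAlgebra.Projection
import HarnessLib

/-!
# Excision for relative singular cohomology

A. Hatcher, *Algebraic Topology* (2002), §3.1, p. 201: "there is a long exact sequence of
cohomology groups of a pair … and excision holds as well, since the excision isomorphism
`Hₙ(X ∖ U, A ∖ U) → Hₙ(X, A)` is induced by a chain map which is a chain homotopy equivalence
[of free chain complexes], hence dualizes to an isomorphism". We carry this out for the relative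
function cochains `C^•(X, A; M)` of `RelativeCochains.lean`:

* `free_quotient_supported`, `projective_quotient_chainsInSub_X`: the quotient chain modules
  `Cₙ(X)/Cₙ(A)` of the tree's concrete singular chain complex are free (on the simplices not in
  `A`; §2.1 p. 115), hence projective in `ModuleCat R`;
* `relCochainComplex.dualIso : C^•(X, A; M) ≅ Hom_R(C(X)/C(A), ULift M)` — relative cochains ARE
  the `Hom`-dual (`dualObj`, `HomDualComplex.lean`) of the concrete quotient complex
  (`Subcomplex.quotient (chainsInSub R R X A)`), levelwise by linear extension / restriction to
  the simplices (`toDual`, `ofDual`), compatibly with the differentials (`toDual_d`) and NATURAL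
  under maps of pairs (`map_comp_dualIso_hom`);
* **`relSingularCohomology.isIso_map_subsetIncl_of_interior`** (excision, subspace form): for
  `interior A ∪ interior B = X` the map of pairs `(B, B ∩ A) → (X, A)` induces isomorphisms
  `Hⁿ(X, A; M) ≅ Hⁿ(B, B ∩ A; M)` — the dual of the tree's chain-level excision quasi-isomorphism
  (`isIso_homologyMap_quotMap_subsetIncl_of_interior`, `ExcisionTheorem.lean`) is a
  quasi-isomorphism (`isIso_homologyMap_dualMap_of_quasiIso`: duals of quasi-isomorphisms
  between `ℕ`-indexed complexes of projectives);
* **`relSingularCohomology.isIso_map_compl_of_closure_subset_interior`**: the form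
  `Hⁿ(X, A; M) ≅ Hⁿ(X ∖ U, A ∖ U; M)` for `closure U ⊆ interior A`.

Everything is proved; no named facts.

## References

* A. Hatcher, *Algebraic Topology*, CUP 2002, §3.1 pp. 199–201, §2.1 p. 115 and Thm. 2.20.
  [Hatcher2002]
-/

set_option backward.isDefEq.respectTransparency false

noncomputable section

open CategoryTheory

universe u v

namespace Literature.AlgebraicTopology.SingularHomology

/-! ### The quotient chain modules `Cₙ(X)/Cₙ(A)` are free -/

section Free

variable (R : Type v) [CommRing R]

/-- **The quotient of a free module `α →₀ R` by the submodule supported on `s` is free** (it is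
`sᶜ →₀ R`: `Finsupp.restrictDom` to `sᶜ` is onto with kernel `Finsupp.supported R R s`;
Hatcher 2002, §2.1: "`Cₙ(X, A) = Cₙ(X)/Cₙ(A)` is free with basis the singular simplices not in
`A`"). [cite: Hatcher2002, §2.1 p. 115] -/
theorem free_quotient_supported {α : Type*} (s : Set α) :
    Module.Free R ((α →₀ R) ⧸ Finsupp.supported R R s) := by
  have h : IsCompl (Finsupp.supported R R s) (Finsupp.supported R R sᶜ) := by
    refine IsCompl.of_eq ?_ ?_
    · exact (Finsupp.disjoint_supported_supported disjoint_compl_right).eq_bot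
    · rw [← Finsupp.supported_union, Set.union_compl_self, Finsupp.supported_univ]
  haveI : Module.Free R (Finsupp.supported R R sᶜ) := free_supported R sᶜ
  exact Module.Free.of_equiv (Submodule.quotientEquivOfIsCompl _ _ h).symm

variable {X : Type u} [TopologicalSpace X]

/-- **The chain modules of the concrete quotient complex `C(X)/C(A)` are free**, hence
projective objects of `ModuleCat R` (Hatcher 2002, §2.1, p. 115). [cite: Hatcher2002, §2.1 p. 115] -/
instance projective_quotient_chainsInSub_X (A : Set X) (n : ℕ) :
    Projective ((chainsInSub R R X A).quotient.X n) := by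
  haveI : Module.Free R (CChain R X n ⧸ chainsIn R R X A n) := free_quotient_supported R _
  haveI : Module.Projective R (CChain R X n ⧸ chainsIn R R X A n) := Module.Projective.of_free
  exact ModuleCat.projective_of_categoryTheory_projective
    (ModuleCat.of R (CChain R X n ⧸ chainsIn R R X A n))

end Free

/-! ### Relative cochains are the dual of the quotient chains -/

section Dual

variable {R : Type v} [CommRing R] {M : Type v} [AddCommGroup M] [Module R M]
variable {X Y : Type u} [TopologicalSpace X] [TopologicalSpace Y]

namespace relCochainComplex

variable {A : Set X} {n : ℕ}

/-- The linear extension of a cochain to concrete chains, `r • σ ↦ r • φ(σ)`, into `ULift M`. [folklore] -/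
def extendLinear (φ : SingularSimplex X n → M) : CChain R X n →ₗ[R] ULift.{u} M :=
  Finsupp.lift (ULift.{u} M) R (SingularSimplex X n) fun σ => ULift.up (φ σ)

/-- `extendLinear φ (r • σ) = r • φ σ`. [folklore] -/
@[simp] lemma extendLinear_single (φ : SingularSimplex X n → M) (σ : SingularSimplex X n) (r : R) :
    extendLinear (R := R) φ (Finsupp.single σ r) = ULift.up (r • φ σ) := by
  rw [extendLinear, Finsupp.lift_apply, Finsupp.sum_single_index (by simp)]
  rfl

/-- A relative cochain kills the chains in `A`. [cite: Hatcher2002, §3.1 p. 199] -/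
lemma chainsIn_le_ker_extendLinear {φ : SingularSimplex X n → M} (hφ : φ ∈ relCochains R M A n) :
    chainsIn R R X A n ≤ LinearMap.ker (extendLinear (R := R) φ) := by
  rw [chainsIn, Finsupp.supported_eq_span_single, Submodule.span_le]
  rintro _ ⟨σ, hσ, rfl⟩
  rw [SetLike.mem_coe, LinearMap.mem_ker, extendLinear_single, one_smul, hφ σ hσ]
  rfl

/-- **The relative cochain as a linear form on `Cₙ(X)/Cₙ(A)`** (Hatcher 2002, §3.1, p. 199:
`Cⁿ(X, A; G) = Hom(Cₙ(X, A), G)`). [cite: Hatcher2002, §3.1 p. 199] -/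
def toDual (φ : (relCochainComplex R M A).X n) :
    ((chainsInSub R R X A).quotient.X n) ⟶ (ModuleCat.of R (ULift.{u} M)) :=
  ModuleCat.ofHom ((chainsIn R R X A n).liftQ (extendLinear (R := R) (val φ))
    (chainsIn_le_ker_extendLinear (val_mem φ)))

/-- `toDual φ [r • σ] = r • φ σ`. [folklore] -/
@[simp] lemma toDual_π_single (φ : (relCochainComplex R M A).X n) (σ : SingularSimplex X n) (r : R) :
    toDual φ ((chainsInSub R R X A).π.f n (Finsupp.single σ r)) = ULift.up (r • val φ σ) := by
  change (chainsIn R R X A n).liftQ (extendLinear (R := R) (val φ)) _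
    (Submodule.Quotient.mk (Finsupp.single σ r)) = _
  rw [Submodule.liftQ_apply, extendLinear_single]

/-- Morphisms out of a quotient chain module agree if they agree on the classes of elementary
chains. [folklore] -/
lemma quotient_hom_ext {N' : ModuleCat.{max u v} R} {f g : ((chainsInSub R R X A).quotient.X n) ⟶ N'}
    (h : ∀ (σ : SingularSimplex X n) (r : R),
      f ((chainsInSub R R X A).π.f n (Finsupp.single σ r)) =
        g ((chainsInSub R R X A).π.f n (Finsupp.single σ r))) : f = g := by
  apply ModuleCat.hom_ext
  apply Submodule.linearMap_qext
  refine Finsupp.lhom_ext fun σ r => ?_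
  exact h σ r

variable (A n) in
/-- The linear map `φ ↦ toDual φ`. [folklore] -/
def toDualHom : (relCochainComplex R M A).X n →ₗ[R] (((chainsInSub R R X A).quotient.X n) ⟶ (ModuleCat.of R (ULift.{u} M))) where
  toFun := toDual
  map_add' φ ψ := quotient_hom_ext fun σ r => by
    rw [toDual_π_single, val_add, Pi.add_apply, smul_add]
    change _ = toDual φ _ + toDual ψ _
    rw [toDual_π_single, toDual_π_single]
    rfl
  map_smul' c φ := quotient_hom_ext fun σ r => by
    rw [toDual_π_single]
    change ULift.up (r • (c • val φ) σ) = c • toDual φ _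
    rw [toDual_π_single, Pi.smul_apply, smul_comm r c]
    rfl

/-- The inverse: restrict a linear form on `Cₙ(X)/Cₙ(A)` to the classes of the simplices; it
vanishes on the simplices in `A`. [cite: Hatcher2002, §3.1 p. 199] -/
def ofDual (ψ : ((chainsInSub R R X A).quotient.X n) ⟶ (ModuleCat.of R (ULift.{u} M))) : (relCochainComplex R M A).X n :=
  mk (fun σ => (ψ ((chainsInSub R R X A).π.f n (Finsupp.single σ 1))).down) fun σ hσ => by
    have h0 : (chainsInSub R R X A).π.f n (Finsupp.single σ (1 : R)) = 0 :=
      ((chainsInSub R R X A).π_f_eq_zero_iff n _).2 (single_mem_chainsIn R R hσ 1)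
    change (ψ ((chainsInSub R R X A).π.f n (Finsupp.single σ 1))).down = 0
    rw [h0, map_zero]
    rfl

/-- `val (ofDual ψ) σ = ψ [1 • σ]`. [folklore] -/
@[simp] lemma val_ofDual_apply (ψ : ((chainsInSub R R X A).quotient.X n) ⟶ (ModuleCat.of R (ULift.{u} M))) (σ : SingularSimplex X n) :
    val (ofDual ψ) σ = (ψ ((chainsInSub R R X A).π.f n (Finsupp.single σ 1))).down := rfl

variable (R M A n) in
/-- **`Cⁿ(X, A; M) ≅ Hom_R(Cₙ(X)/Cₙ(A), M)` levelwise** (Hatcher 2002, §3.1, p. 199).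
[cite: Hatcher2002, §3.1 p. 199] -/
def dualXIso : (relCochainComplex R M A).X n ≅
    (dualObj R (ModuleCat.of R (ULift.{u} M)) (chainsInSub R R X A).quotient).X n where
  hom := ModuleCat.ofHom (toDualHom A n)
  inv := ModuleCat.ofHom
    { toFun := ofDual
      map_add' := fun _ _ => relCochainComplex.val_injective (funext fun _ => rfl)
      map_smul' := fun _ _ => relCochainComplex.val_injective (funext fun _ => rfl) }
  hom_inv_id := by
    refine ModuleCat.hom_ext (LinearMap.ext fun φ => relCochainComplex.val_injective
      (funext fun σ => ?_))
    change val (ofDual (toDual φ)) σ = val φ σ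
    rw [val_ofDual_apply, toDual_π_single, one_smul]
  inv_hom_id := by
    refine ModuleCat.hom_ext (LinearMap.ext fun ψ => ?_)
    change toDual (ofDual ψ) = ψ
    refine quotient_hom_ext fun σ r => ?_
    rw [toDual_π_single, val_ofDual_apply]
    have h : (chainsInSub R R X A).π.f n (Finsupp.single σ r) =
        r • (chainsInSub R R X A).π.f n (Finsupp.single σ (1 : R)) := by
      rw [← map_smul, Finsupp.smul_single, smul_eq_mul, mul_one]
    rw [h, map_smul]
    rfl

/-- `dualXIso.hom` on elements is `toDual`. [folklore] -/
lemma dualXIso_hom_apply (φ : (relCochainComplex R M A).X n) :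
    (dualXIso R M A n).hom φ = toDual φ := rfl

/-- **`toDual` intertwines the coboundary with the dual of the boundary**:
`toDual (δφ) = ∂ ≫ toDual φ` (Hatcher 2002, §3.1, `δ = ∂*`). [cite: Hatcher2002, §3.1 p. 199] -/
lemma toDual_d (φ : (relCochainComplex R M A).X n) :
    toDual ((relCochainComplex R M A).d n (n + 1) φ) =
      (chainsInSub R R X A).quotient.d (n + 1) n ≫ toDual φ := by
  refine quotient_hom_ext fun τ r => ?_
  rw [toDual_π_single, val_d, singularCochainComplex.d_apply, ModuleCat.comp_apply,
    Subcomplex.quotient_d_π_f, csingularChainComplex.d_single, map_sum, map_sum, Finset.smul_sum]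
  change ULift.up (∑ i, _) = _
  have hu : ULift.up (∑ i : Fin (n + 2), r • ((-1 : R) ^ (i : ℕ) • val φ (τ.face i))) =
      ∑ i : Fin (n + 2), ULift.up (r • ((-1 : R) ^ (i : ℕ) • val φ (τ.face i))) :=
    map_sum (ULift.moduleEquiv (R := R) (M := M)).symm _ _
  rw [hu]
  refine Finset.sum_congr rfl fun i _ => ?_
  rw [Finsupp.smul_single, toDual_π_single, smul_eq_mul, mul_comm ((-1 : R) ^ (i : ℕ)) r, mul_smul]

variable (R M A) in
/-- **Relative cochains are the `Hom`-dual of the quotient chain complex**: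
`C^•(X, A; M) ≅ Hom_R(C(X)/C(A), M)` as cochain complexes (Hatcher 2002, §3.1, p. 199).
[cite: Hatcher2002, §3.1 p. 199] -/
def dualIso : relCochainComplex R M A ≅ dualObj R (ModuleCat.of R (ULift.{u} M)) (chainsInSub R R X A).quotient :=
  HomologicalComplex.Hom.isoOfComponents (fun n => dualXIso R M A n) fun i j hij => by
    obtain rfl : i + 1 = j := hij
    refine ModuleCat.hom_ext (LinearMap.ext fun φ => ?_)
    change (dualObj R (ModuleCat.of R (ULift.{u} M)) (chainsInSub R R X A).quotient).d i (i + 1) (toDual φ) =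
      toDual ((relCochainComplex R M A).d i (i + 1) φ)
    rw [dualObj_d_apply, toDual_d]

/-- **Naturality of `dualIso`** under maps of pairs: `f♯` on relative cochains is the dual of
the induced map of quotient chain complexes. [folklore] -/
lemma map_comp_dualIso_hom {B : Set Y} (f : C(X, Y)) (h : Set.MapsTo f A B) :
    relCochainComplex.map R M f h ≫ (dualIso R M A).hom =
      (dualIso R M B).hom ≫ dualMap R (ModuleCat.of R (ULift.{u} M)) (Subcomplex.quotMap (csingularChainComplex.map R R f)
        (chainsInSub R R X A) (chainsInSub R R Y B) (chainsInSub_le_comap_map R R f h)) := by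
  refine HomologicalComplex.hom_ext _ _ fun n => ModuleCat.hom_ext (LinearMap.ext fun φ => ?_)
  change toDual ((relCochainComplex.map R M f h).f n φ) =
    (dualMap R (ModuleCat.of R (ULift.{u} M)) (Subcomplex.quotMap (csingularChainComplex.map R R f)
        (chainsInSub R R X A) (chainsInSub R R Y B) (chainsInSub_le_comap_map R R f h))).f n
      (toDual φ)
  rw [dualMap_f_apply]
  refine quotient_hom_ext fun σ r => ?_
  rw [toDual_π_single, val_map_f, singularCochainComplex.map_apply, ModuleCat.comp_apply,
    Subcomplex.quotMap_f_π_f, csingularChainComplex.map_f_single, toDual_π_single]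

end relCochainComplex

end Dual

/-! ### Excision for relative singular cohomology -/

section Excision

variable (R : Type v) [CommRing R] (M : Type v) [AddCommGroup M] [Module R M]
variable {X : Type u} [TopologicalSpace X]

/-- **Excision for relative cohomology, subspace form** (Hatcher 2002, §3.1 p. 201 with
Thm. 2.20): if the interiors of `A` and `B` cover `X`, the map of pairs `(B, B ∩ A) → (X, A)`
induces isomorphisms `Hⁿ(X, A; M) ≅ Hⁿ(B, B ∩ A; M)` for all `n` (with `B` the subspace `↥B` and
`B ∩ A` its subset `val ⁻¹' A`). Proof: under `dualIso` the map is the dual of the chain-level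
excision quasi-isomorphism between the free quotient complexes (the tree's
`isIso_homologyMap_quotMap_subsetIncl_of_interior`), and duals of quasi-isomorphisms of complexes
of projectives are quasi-isomorphisms (`isIso_homologyMap_dualMap_of_quasiIso`).
[cite: Hatcher2002, §3.1 p. 201] -/
theorem relSingularCohomology.isIso_map_subsetIncl_of_interior (A B : Set X)
    (hAB : interior A ∪ interior B = Set.univ) (n : ℕ) :
    IsIso (relSingularCohomology.map R M (subsetIncl B)
      (Set.mapsTo_preimage Subtype.val A : Set.MapsTo (subsetIncl B) (Subtype.val ⁻¹' A) A) n) := by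
  set q := Subcomplex.quotMap (csingularChainComplex.map R R (subsetIncl B))
    (chainsInSub R R (↥B) (Subtype.val ⁻¹' A)) (chainsInSub R R X A)
    (chainsInSub_le_comap_map R R (subsetIncl B) (Set.mapsTo_preimage Subtype.val A)) with hq
  haveI : QuasiIso q := ⟨fun k => by
    rw [quasiIsoAt_iff_isIso_homologyMap]
    exact isIso_homologyMap_quotMap_subsetIncl_of_interior R R A B hAB k⟩
  have e : relCochainComplex.map R M (subsetIncl B) (Set.mapsTo_preimage Subtype.val A) =
      (relCochainComplex.dualIso R M A).hom ≫ dualMap R (ModuleCat.of R (ULift.{u} M)) q ≫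
        (relCochainComplex.dualIso R M (Subtype.val ⁻¹' A)).inv := by
    rw [← Category.assoc, ← relCochainComplex.map_comp_dualIso_hom, Category.assoc, Iso.hom_inv_id,
      Category.comp_id]
  change IsIso (HomologicalComplex.homologyMap (relCochainComplex.map R M (subsetIncl B) _) n)
  rw [e, HomologicalComplex.homologyMap_comp, HomologicalComplex.homologyMap_comp]
  haveI := isIso_homologyMap_dualMap_of_quasiIso (N := ModuleCat.of R (ULift.{u} M)) q n
  infer_instance

/-- **Excision for relative cohomology** (Hatcher 2002, §3.1 p. 201 with Thm. 2.20, first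
form): for `closure U ⊆ interior A`, the map of pairs `(X ∖ U, A ∖ U) → (X, A)` induces
isomorphisms `Hⁿ(X, A; M) ≅ Hⁿ(X ∖ U, A ∖ U; M)` for all `n` (`X ∖ U` the subspace `↥Uᶜ`).
[cite: Hatcher2002, §3.1 p. 201] -/
theorem relSingularCohomology.isIso_map_compl_of_closure_subset_interior (A U : Set X)
    (hUA : closure U ⊆ interior A) (n : ℕ) :
    IsIso (relSingularCohomology.map R M (subsetIncl Uᶜ)
      (Set.mapsTo_preimage Subtype.val A : Set.MapsTo (subsetIncl Uᶜ) (Subtype.val ⁻¹' A) A) n) := by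
  have hcov : interior A ∪ interior Uᶜ = Set.univ := by
    rw [interior_compl]
    exact Set.eq_univ_of_forall fun x => (em (x ∈ closure U)).elim
      (fun hx => Or.inl (hUA hx)) Or.inr
  exact relSingularCohomology.isIso_map_subsetIncl_of_interior R M A Uᶜ hcov n

end Excision

end Literature.AlgebraicTopology.SingularHomology
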